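import Summits.QuantumFields.YangMills.Theorems.BalabanUVNodesN22KernelLimitOfSoftMajorants
import Summits.QuantumFields.YangMills.Theorems.BalabanUVNodesN18FiniteVolumeLettersModel

/-!
# THE A6 RESIDUE OF THE (1.21)-EXISTENCE HALF — THE NESTED-TERMS MODEL: a NON-DEGENERATE inhabitant of BOTH existence schemas of this lineage
# (hard road `polLimitExists_sum_of_stable_tail`, p597055; soft road `polLimitExists_sum_of_approxStable_tail`, p606602) through def-B's ACTUAL
# `polScalar ∘ expChart ∘ siteOfInt` machinery, by VOLUME-GROWING localized sums whose windowed kernels are NOT eventually constant in the volume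

Cell `pub-ymgap`, Track A (HUMAN RULING D-0062), WIDTH SEAT `dag-n22-w3` g5 on node n22 = NE9, A6-residue lane; `--kind proof --supports stmt-QuantumFields-27366 --as helper`
(KEY MAP v2), COUNT-NEUTRAL.  THEOREMS ONLY (0 `def`, 0 `sorry`, standard axioms).

WHY.  The (1.21)-existence road of this lineage — [I] p. 264 «Now we take a limit of these functions as T^{(j+1)} ↗ Z^d.  This limit exists by the localized representation
(1.7)»: the terms of domains NOT feeling the volume are the same on every larger torus ((S), exactly, or (S≈), up to `C₀ r₀^K` on the soft road), the volume-feeling ones are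
exponentially few ((T), `≤ C r^K`), hence geometric volume-increments, hence Cauchy, hence the limit — is typed as the two SCHEMAS above (abstract index types `𝒳 K` of the
terms of the `K`-th torus) and fed by dag-n22-w3 g2's `polLimitExists_of_eventually_geometric_increments` (p595960).  Every inhabitant of that road in the tree is DEGENERATE:
g2's `polLimitExists_zeroChart` (the zero chart), g3∕g4's `…_fires_zeroTower` (the tower `⟨PUnit, ∅, 0⟩`, declared degenerate), dag-n18-w2 g9's
`polLimitsExist_localizedSum_of_truncationStable_fires_zeroChart` (the truncation road's smoke at `ρ = 0`), and dag-n18-w2's on-site ∕ two-bond models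
(`polWindow_fadingTermFamily_eventually`, `polWindow_crossTermFamily_eventually`), whose windowed kernels are EVENTUALLY CONSTANT in `K` (`GeometricIncrements` with the
constant `C := 0`): the Cauchy mechanism is never exercised with a non-zero increment.  THIS FILE exercises it.

THE MODEL (scalar algebra `𝔄 = V = ℝ`, chart `ρ = id`, one-colour basis `Module.Basis.singleton Unit ℝ`; test functionals, NOT Bałaban's (2.13) terms).  On the `K`-th torus
the localized sum has the `K + 1` terms `i = 0, …, K` — read: the classes, by linear size, of the localization domains through the window origin; class `K + 1` first fits on
the `(K+1)`-th torus —, term `i` being the ON-SITE evaluation functional `W ↦ a K i · W 0 (siteOfInt F K j 0)` with an amplitude array `a : ℕ → ℕ → ℝ` (free in §1–§3), then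
`a K i := r^i` (HARD road, §4: volume-blind small classes; the SOFT instance `a K i := r^i · (1 − s^{K+1})` — the terms read the volume weakly, as they do through the
minimizer — is the sequel's), `0 ≤ r < 1`.

* §1 closed forms — `contDiffAt_expChart_onSite` ((C²) of the schemas), ★ `polScalar_onSite` (def-B's scalar kernel of an on-site term at the window sites:
  `c · [μ = ν = 0 ∧ siteOfInt z = siteOfInt 0]`, dag-n18-w2's `polTensor_expChart_evalMul` BY NAME), `polWindow_nested` (the windowed kernel of the nested sum =
  `(Σ_{i ≤ K} a K i) · [⋯]`), `polWindow_nested_eventually` (the torus window separates `z ≠ 0` from the origin eventually: dag-n18-w2's `siteOfInt_eventually_ne`).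
* §2 ★★★ `polLimitExists_nested_of_volumeBlind` — THE HARD SCHEMA FIRES (p597055 `polLimitExists_sum_of_stable_tail` BY NAME): volume-blind small classes
  (`a (K+1) i = a K i`, `i ≤ K`) give (S) EXACTLY from the window-separation threshold on; ONE volume-feeling class `K + 1` with `|a (K+1) (K+1)| ≤ C r^K` gives (T).
* §3 ★★★ `polLimitExists_nested_of_approxBlind` — THE SOFT SCHEMA FIRES (p606602 `polLimitExists_sum_of_approxStable_tail` BY NAME): `|Σ_{i ≤ K} (a (K+1) i − a K i)| ≤ C₀ s^K`
  gives (S≈), the same tail gives (T).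
* §4 THE HARD INSTANCE `a K i := r^i` and its NON-DEGENERACY: ★★ `polLimitExists_nested_hard`; `polWindow_nested_hard_origin` (the kernel at the entry `(0, 0, 0)` is the geometric
  sum `Σ_{i ≤ K} r^i` at EVERY volume), ★★ `strictMono_polWindow_nested_hard` ⇒ `not_eventuallyConst_polWindow_nested_hard` (g2's `polLimitExists_of_eventually_const` does NOT
  apply) and `not_zeroIncrements_polWindow_nested_hard` (the increments letter holds at NO constant `0`, unlike every model in the tree); ★★ `tendsto_polWindow_nested_hard` ∕
  `polLimit_nested_hard` (def-B's TOTAL `polLimit` IN CLOSED FORM `[μ = ν = 0][z = 0] · (1 − r)⁻¹` — non-zero, attained at NO finite volume: `polLimit_nested_hard_ne_polWindow`);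
  ★ `polLimit_sub_polWindow_nested_hard` (the distance to the limit is EXACTLY `r^{K+1} ∕ (1 − r)`: dag-n18-w2's rate `abs_sub_limUnder_le_of_eventually_geometric` with `C = r`,
  `K₀ = 0` is ATTAINED — `rate_sharp_nested_hard`).
* The SOFT instance `a K i := r^i (1 − s^{K+1})` (exact (S) FAILS at every volume, the soft schema fires) and the coupling-reading `TermFamily1` packaging (W1-19b
  letters with NON-ZERO increment constants; NE9 ∕ `N22At` through dag-n22-w3 g2's `…_of_increments_of_windowed`) are the sequel `…NestedTermsModelLetters`.

HONEST FRAMING (binding).  A MODEL-LEVEL A6 witness: the (S)∕(S≈) + (T) ⇒ Cauchy ⇒ (1.21) schemas of this lineage are jointly satisfiable NON-DEGENERATELY through def-B's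
actual (1.20)–(1.21) definitions (`polScalar`, `polWindow`, `polLimit`, `siteOfInt`).  NOT Bałaban's (2.13) terms; NOT def-W1's `localizedSum` of a `ClusterTower` of record
(a non-degenerate inhabitant THERE needs the cross-volume identification of def-T's small domains — NODE A ∕ def-T content, not w-sized); inhabits NO letter OF RECORD;
nothing of Bałaban's asserted or constructed; (1.21)'s existence for the terms OF RECORD is NOT proved; N22 NOT discharged; K3⁸ `SpineGivenEndpointR13SepCoPHV` OPEN, not
claimed, no stub touched; counts UNMOVED (typed 28∕28 · discharged 5∕27; the chair's single count line is the only count); one finite 𝕋⁴ programme at fixed ε — R4 closes the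
CONDITIONAL rung `BalabanLadder.UV` only; NOTHING about the continuum limit, ℝ⁴, OS axioms or a mass gap is proved or claimed; the Yang–Mills mass gap (Clay) is NOT proved by
any of this.  No decl below carries a cite tag (Summit side); TYPES only: [I] = [Balaban1987RG1] CMP **109** (1987) (1.7) p. 261, (1.18) p. 263, (1.20)–(1.21) p. 264.
-/

noncomputable section

open Filter Topology
open scoped BigOperators

namespace YMDAG.N22.AtKernels.NestedTermsModel

open Literature.MathematicalPhysics.QuantumFieldTheory.Balaban1983to89
open Literature.MathematicalPhysics.QuantumFieldTheory.Balaban1983to89.T4Continuum (T4Family)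
open Literature.MathematicalPhysics.QuantumFieldTheory.Balaban1983to89.B12PolarizationTensor120 (polTensor polComp expChart)
open Literature.MathematicalPhysics.QuantumFieldTheory.Balaban1983to89.Node00 (siteOfInt polScalar polWindow polLimit PolLimitExists)
open YMDAG.N22.AtKernels (polLimitExists_sum_of_stable_tail polLimitExists_sum_of_approxStable_tail)
open YMDAG.N18.FiniteVolumeLettersModel (bondEval bondEval_apply expChart_evalMul polTensor_expChart_evalMul siteOfInt_eventually_ne)
open YMDAG.N18.PolLimitRate (abs_sub_limUnder_le_of_eventually_geometric)

variable (F : T4Family)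

/-! ## §1 Closed forms: the on-site term, its chart, def-B's scalar kernel and the windowed kernel of the nested sum -/

section ClosedForms

/-- **(C²) OF THE SCHEMAS AT THE MODEL**: the exponential chart `B ↦ c · e^{B 0 x₀}` of the on-site term `W ↦ c · W 0 x₀` (`x₀` the window origin of the `K`-th torus) is
twice continuously differentiable at `0` (indeed smooth: dag-n18-w2's `expChart_evalMul`, `Real.contDiff_exp`). -/
theorem contDiffAt_expChart_onSite (K j : ℕ) (c : ℝ) :
    ContDiffAt ℝ 2 (expChart (F := ℝ) (fun W : Fin (F.P K).d → Site (F.P K) j → ℝ => c * W (Fin.cast (F.P_d K).symm 0) (siteOfInt F K j 0))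
      (ContinuousLinearMap.id ℝ ℝ)) 0 := by
  rw [expChart_evalMul]
  simp only [bondEval_apply]
  exact (contDiff_const.mul (Real.contDiff_exp.comp (contDiff_apply_apply ℝ ℝ _ _))).contDiffAt

/-- ★ **def-B's SCALAR KERNEL OF AN ON-SITE TERM AT THE WINDOW SITES, IN CLOSED FORM**: for `W ↦ c · W 0 (siteOfInt F K j 0)` (scalar model, `ρ = id`, one-colour basis) the
(1.20) scalar kernel at the window sites `(siteOfInt z, siteOfInt 0)` in directions `(μ, ν)` is `c` when `μ = ν = 0` and the window sends `z` to the torus origin, else `0`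
(dag-n18-w2's `polTensor_expChart_evalMul` BY NAME).  The per-term quantity the schemas' (S)∕(S≈)∕(T) clauses read. -/
theorem polScalar_onSite (K j : ℕ) (c : ℝ) (μ ν : Fin 4) (z : Fin 4 → ℤ) :
    polScalar (fun W : Fin (F.P K).d → Site (F.P K) j → ℝ => c * W (Fin.cast (F.P_d K).symm 0) (siteOfInt F K j 0)) (ContinuousLinearMap.id ℝ ℝ)
        (Module.Basis.singleton Unit ℝ) (Fin.cast (F.P_d K).symm μ) (siteOfInt F K j z) (Fin.cast (F.P_d K).symm ν) (siteOfInt F K j 0) =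
      if μ = 0 ∧ ν = 0 ∧ siteOfInt F K j z = siteOfInt F K j 0 then c else 0 := by
  unfold polScalar
  simp only [polComp, Module.Basis.singleton_apply, Fintype.card_unique, Nat.cast_one, inv_one, one_mul, Finset.univ_unique,
    Finset.sum_singleton, polTensor_expChart_evalMul]
  have hμ : ∀ μ' : Fin 4, (Fin.cast (F.P_d K).symm 0 = Fin.cast (F.P_d K).symm μ') ↔ μ' = 0 := fun μ' =>
    ⟨fun h => (Fin.cast_injective _ h).symm, fun h => by rw [h]⟩
  simp only [Pi.single_apply, hμ]
  by_cases h0 : μ = 0 <;> by_cases h1 : ν = 0 <;> by_cases h2 : siteOfInt F K j z = siteOfInt F K j 0 <;> simp [h0, h1, h2, eq_comm]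

/-- The windowed kernel of ONE on-site term (def-B's `polWindow` unfolds to `polScalar` at the window sites). -/
theorem polWindow_onSite (K j : ℕ) (c : ℝ) (μ ν : Fin 4) (z : Fin 4 → ℤ) :
    polWindow F K j (fun W : Fin (F.P K).d → Site (F.P K) j → ℝ => c * W (Fin.cast (F.P_d K).symm 0) (siteOfInt F K j 0)) (ContinuousLinearMap.id ℝ ℝ)
        (Module.Basis.singleton Unit ℝ) μ ν z =
      if μ = 0 ∧ ν = 0 ∧ siteOfInt F K j z = siteOfInt F K j 0 then c else 0 :=
  polScalar_onSite F K j c μ ν z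

/-- **THE WINDOWED KERNEL OF THE NESTED SUM, IN CLOSED FORM**: the localized sum `W ↦ Σ_{i ≤ K} a K i · W 0 (siteOfInt F K j 0)` of the `K`-th torus IS the on-site term of
amplitude `Σ_{i ≤ K} a K i`, so its windowed kernel is `(Σ_{i ≤ K} a K i) · [μ = ν = 0 ∧ siteOfInt z = siteOfInt 0]`. -/
theorem polWindow_nested (a : ℕ → ℕ → ℝ) (K j : ℕ) (μ ν : Fin 4) (z : Fin 4 → ℤ) :
    polWindow F K j (fun W : Fin (F.P K).d → Site (F.P K) j → ℝ =>
        ∑ i ∈ Finset.range (K + 1), a K i * W (Fin.cast (F.P_d K).symm 0) (siteOfInt F K j 0)) (ContinuousLinearMap.id ℝ ℝ) (Module.Basis.singleton Unit ℝ) μ ν z =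
      if μ = 0 ∧ ν = 0 ∧ siteOfInt F K j z = siteOfInt F K j 0 then ∑ i ∈ Finset.range (K + 1), a K i else 0 := by
  have e : (fun W : Fin (F.P K).d → Site (F.P K) j → ℝ => ∑ i ∈ Finset.range (K + 1), a K i * W (Fin.cast (F.P_d K).symm 0) (siteOfInt F K j 0)) =
      fun W => (∑ i ∈ Finset.range (K + 1), a K i) * W (Fin.cast (F.P_d K).symm 0) (siteOfInt F K j 0) :=
    funext fun W => (Finset.sum_mul _ _ _).symm
  rw [e]
  exact polWindow_onSite F K j _ μ ν z

/-- **EVENTUALLY THE WINDOW READS `ℤ⁴` FAITHFULLY**: from some volume on, «`siteOfInt z = siteOfInt 0`» IS «`z = 0`» (dag-n18-w2's `siteOfInt_eventually_ne`). -/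
theorem eventually_siteOfInt_eq_iff (j : ℕ) (z : Fin 4 → ℤ) : ∀ᶠ K in atTop, (siteOfInt F K j z = siteOfInt F K j 0 ↔ z = 0) := by
  by_cases hz : z = 0
  · subst hz
    exact Eventually.of_forall fun K => by simp
  · filter_upwards [siteOfInt_eventually_ne F j hz] with K hK
    exact ⟨fun h => (hK h).elim, fun h => (hz h).elim⟩

/-- The same at TWO CONSECUTIVE volumes at once, as a threshold (the form the schemas' `∃ K₀` clauses use). -/
theorem exists_threshold_siteOfInt (j : ℕ) (z : Fin 4 → ℤ) : ∃ K₀ : ℕ, ∀ K, K₀ ≤ K →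
    (siteOfInt F K j z = siteOfInt F K j 0 ↔ z = 0) ∧ (siteOfInt F (K + 1) j z = siteOfInt F (K + 1) j 0 ↔ z = 0) := by
  obtain ⟨K₀, hK₀⟩ := eventually_atTop.1 (eventually_siteOfInt_eq_iff F j z)
  exact ⟨K₀, fun K hK => ⟨hK₀ K hK, hK₀ (K + 1) (hK.trans (Nat.le_succ K))⟩⟩

/-- **EVENTUALLY THE WINDOWED KERNEL OF THE NESTED SUM IS** `(Σ_{i ≤ K} a K i) · [μ = ν = 0][z = 0]` — still a function of the volume `K` through the number and the
amplitudes of its terms (contrast: dag-n18-w2's models are eventually CONSTANT in `K`). -/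
theorem polWindow_nested_eventually (a : ℕ → ℕ → ℝ) (j : ℕ) (μ ν : Fin 4) (z : Fin 4 → ℤ) :
    ∀ᶠ K in atTop, polWindow F K j (fun W : Fin (F.P K).d → Site (F.P K) j → ℝ =>
        ∑ i ∈ Finset.range (K + 1), a K i * W (Fin.cast (F.P_d K).symm 0) (siteOfInt F K j 0)) (ContinuousLinearMap.id ℝ ℝ) (Module.Basis.singleton Unit ℝ) μ ν z =
      if μ = 0 ∧ ν = 0 ∧ z = 0 then ∑ i ∈ Finset.range (K + 1), a K i else 0 := by
  filter_upwards [eventually_siteOfInt_eq_iff F j z] with K hK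
  rw [polWindow_nested]
  exact if_congr (and_congr Iff.rfl (and_congr Iff.rfl hK)) rfl rfl

/-- At the ORIGIN ENTRY `(μ, ν, z) = (0, 0, 0)` the windowed kernel of the nested sum is `Σ_{i ≤ K} a K i` at EVERY volume (no threshold). -/
theorem polWindow_nested_origin (a : ℕ → ℕ → ℝ) (K j : ℕ) :
    polWindow F K j (fun W : Fin (F.P K).d → Site (F.P K) j → ℝ =>
        ∑ i ∈ Finset.range (K + 1), a K i * W (Fin.cast (F.P_d K).symm 0) (siteOfInt F K j 0)) (ContinuousLinearMap.id ℝ ℝ) (Module.Basis.singleton Unit ℝ) 0 0 0 =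
      ∑ i ∈ Finset.range (K + 1), a K i := by
  rw [polWindow_nested]; simp

end ClosedForms

/-! ## §2 THE HARD SCHEMA FIRES: volume-blind small classes (exact (S)) + one geometrically small volume-feeling class ((T)) -/

section Hard

/-- The small classes of the `K`-th torus are all of its classes; the small classes of the `(K+1)`-th torus are all but the top one; the complements. -/
theorem filter_range_le (K : ℕ) : (Finset.range (K + 1)).filter (fun i => i ≤ K) = Finset.range (K + 1) :=
  Finset.filter_true_of_mem fun _ hi => Nat.lt_succ_iff.1 (Finset.mem_range.1 hi)

/-- See `filter_range_le`. -/
theorem filter_range_succ_le (K : ℕ) : (Finset.range (K + 2)).filter (fun i => i ≤ K) = Finset.range (K + 1) := by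
  ext i; simp only [Finset.mem_filter, Finset.mem_range]; omega

/-- See `filter_range_le`. -/
theorem filter_range_not_le (K : ℕ) : (Finset.range (K + 1)).filter (fun i => ¬ i ≤ K) = ∅ :=
  Finset.filter_false_of_mem fun _ hi => not_not.2 (Nat.lt_succ_iff.1 (Finset.mem_range.1 hi))

/-- See `filter_range_le`. -/
theorem filter_range_succ_not_le (K : ℕ) : (Finset.range (K + 2)).filter (fun i => ¬ i ≤ K) = {K + 1} := by
  ext i; simp only [Finset.mem_filter, Finset.mem_range, Finset.mem_singleton]; omega

/-- ★★★ **THE HARD SCHEMA FIRES AT THE NESTED-TERMS MODEL** (p597055 `polLimitExists_sum_of_stable_tail` BY NAME, index types `𝒳 K := ℕ`, terms `range (K + 1)`, small classes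
`i ≤ K` in both volumes): if the amplitudes of the small classes are VOLUME-BLIND (`a (K+1) i = a K i` for `i ≤ K` — the (2.13) term of a domain not wrapping the torus does not
depend on the volume) and the ONE volume-feeling class is geometrically small (`|a (K+1) (K+1)| ≤ C r^K`, `0 ≤ r < 1`), then (S) holds EXACTLY from the window-separation
threshold on, (T) holds with the constant `|C|`, and def-B's `PolLimitExists` follows for the nested sums.  Both (S)-sides and the (T)-tail are NON-ZERO at the origin entry
whenever the amplitudes are (§4). -/
theorem polLimitExists_nested_of_volumeBlind (a : ℕ → ℕ → ℝ) (j : ℕ) {r C : ℝ} (hr : r < 1) (hr₀ : 0 ≤ r)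
    (hblind : ∀ K i, i ≤ K → a (K + 1) i = a K i) (htail : ∀ K, |a (K + 1) (K + 1)| ≤ C * r ^ K) :
    PolLimitExists F j (fun K (W : Fin (F.P K).d → Site (F.P K) j → ℝ) =>
        ∑ i ∈ Finset.range (K + 1), a K i * W (Fin.cast (F.P_d K).symm 0) (siteOfInt F K j 0)) (ContinuousLinearMap.id ℝ ℝ) (Module.Basis.singleton Unit ℝ) := by
  refine polLimitExists_sum_of_stable_tail F j (ContinuousLinearMap.id ℝ ℝ) (Module.Basis.singleton Unit ℝ) (fun _ => ℕ) (fun K => Finset.range (K + 1))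
    (fun K i W => a K i * W (Fin.cast (F.P_d K).symm 0) (siteOfInt F K j 0)) (fun K i _ => contDiffAt_expChart_onSite F K j (a K i))
    (fun K i => i ≤ K) (fun K i => i ≤ K) hr fun μ ν z => ?_
  obtain ⟨K₀, hK₀⟩ := exists_threshold_siteOfInt F j z
  refine ⟨K₀, |C|, fun K hK => ?_⟩
  obtain ⟨h₁, h₂⟩ := hK₀ K hK
  simp only [polScalar_onSite, h₁, h₂, filter_range_le, filter_range_succ_le, filter_range_not_le, filter_range_succ_not_le, Finset.sum_empty,
    Finset.sum_singleton]
  refine ⟨Finset.sum_congr rfl fun i hi => ?_, by positivity, ?_⟩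
  · rw [hblind K i (Nat.lt_succ_iff.1 (Finset.mem_range.1 hi))]
  · split_ifs
    · exact (htail K).trans (mul_le_mul_of_nonneg_right (le_abs_self C) (pow_nonneg hr₀ K))
    · rw [abs_zero]; positivity

end Hard

/-! ## §3 THE SOFT SCHEMA FIRES: approximately volume-blind small classes ((S≈)) + the same tail ((T)) -/

section Soft

/-- ★★★ **THE SOFT SCHEMA FIRES AT THE NESTED-TERMS MODEL** (p606602 `polLimitExists_sum_of_approxStable_tail` BY NAME): if the small classes' total amplitude is only
APPROXIMATELY volume-blind (`|Σ_{i ≤ K} (a (K+1) i − a K i)| ≤ C₀ s^K`, `0 ≤ s < 1` — on the soft road the terms read the probe through the volume's minimizer) and the volume-feeling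
class is geometrically small (`|a (K+1) (K+1)| ≤ C₁ r^K`, `0 ≤ r < 1`), then (S≈) and (T) hold from the window-separation threshold on and def-B's `PolLimitExists` follows. -/
theorem polLimitExists_nested_of_approxBlind (a : ℕ → ℕ → ℝ) (j : ℕ) {r s C₀ C₁ : ℝ} (hr : r < 1) (hr₀ : 0 ≤ r) (hs : s < 1) (hs₀ : 0 ≤ s)
    (happrox : ∀ K, |∑ i ∈ Finset.range (K + 1), (a (K + 1) i - a K i)| ≤ C₀ * s ^ K) (htail : ∀ K, |a (K + 1) (K + 1)| ≤ C₁ * r ^ K) :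
    PolLimitExists F j (fun K (W : Fin (F.P K).d → Site (F.P K) j → ℝ) =>
        ∑ i ∈ Finset.range (K + 1), a K i * W (Fin.cast (F.P_d K).symm 0) (siteOfInt F K j 0)) (ContinuousLinearMap.id ℝ ℝ) (Module.Basis.singleton Unit ℝ) := by
  refine polLimitExists_sum_of_approxStable_tail F j (ContinuousLinearMap.id ℝ ℝ) (Module.Basis.singleton Unit ℝ) (fun _ => ℕ) (fun K => Finset.range (K + 1))
    (fun K i W => a K i * W (Fin.cast (F.P_d K).symm 0) (siteOfInt F K j 0)) (fun K i _ => contDiffAt_expChart_onSite F K j (a K i))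
    (fun K i => i ≤ K) (fun K i => i ≤ K) hs hs₀ hr hr₀ (fun μ ν z => ?_) (fun μ ν z => ⟨0, |C₁|, fun K _ => ?_⟩) (fun μ ν z => ?_)
  · -- (S≈)
    obtain ⟨K₀, hK₀⟩ := exists_threshold_siteOfInt F j z
    refine ⟨K₀, |C₀|, fun K hK => ?_⟩
    obtain ⟨h₁, h₂⟩ := hK₀ K hK
    simp only [polScalar_onSite, h₁, h₂, filter_range_le, filter_range_succ_le]
    split_ifs
    · rw [← Finset.sum_sub_distrib]
      exact (happrox K).trans (mul_le_mul_of_nonneg_right (le_abs_self C₀) (pow_nonneg hs₀ K))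
    · rw [sub_self, abs_zero]; positivity
  · -- (T) in volume `K`: no volume-feeling class
    simp only [filter_range_not_le, Finset.sum_empty]; positivity
  · -- (T) in volume `K + 1`: the one class `K + 1`
    obtain ⟨K₀, hK₀⟩ := exists_threshold_siteOfInt F j z
    refine ⟨K₀, |C₁|, fun K hK => ?_⟩
    simp only [polScalar_onSite, (hK₀ K hK).2, filter_range_succ_not_le, Finset.sum_singleton]
    split_ifs
    · exact (htail K).trans (mul_le_mul_of_nonneg_right (le_abs_self C₁) (pow_nonneg hr₀ K))
    · rw [abs_zero]; positivity

end Soft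

/-! ## §4 THE HARD INSTANCE `a K i := r^i` AND ITS NON-DEGENERACY -/

section HardInstance

variable {r : ℝ}

/-- ★★ **(1.21) EXISTS FOR THE HARD NESTED-TERMS FAMILY** `W ↦ Σ_{i ≤ K} r^i · W 0 (siteOfInt F K j 0)` (`0 ≤ r < 1`), BY THE HARD SCHEMA: small classes volume-blind by `rfl`,
the volume-feeling class has amplitude `r^{K+1} = r · r^K`. -/
theorem polLimitExists_nested_hard (j : ℕ) (hr : r < 1) (hr₀ : 0 ≤ r) :
    PolLimitExists F j (fun K (W : Fin (F.P K).d → Site (F.P K) j → ℝ) =>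
        ∑ i ∈ Finset.range (K + 1), r ^ i * W (Fin.cast (F.P_d K).symm 0) (siteOfInt F K j 0)) (ContinuousLinearMap.id ℝ ℝ) (Module.Basis.singleton Unit ℝ) :=
  polLimitExists_nested_of_volumeBlind F (fun _ i => r ^ i) j hr hr₀ (fun _ _ _ => rfl) fun K => by
    rw [abs_of_nonneg (pow_nonneg hr₀ _), pow_succ, mul_comm]

/-- **THE KERNEL AT THE ORIGIN ENTRY IS THE GEOMETRIC SUM** `Σ_{i ≤ K} r^i` at EVERY volume `K`. -/
theorem polWindow_nested_hard_origin (K j : ℕ) :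
    polWindow F K j (fun W : Fin (F.P K).d → Site (F.P K) j → ℝ =>
        ∑ i ∈ Finset.range (K + 1), r ^ i * W (Fin.cast (F.P_d K).symm 0) (siteOfInt F K j 0)) (ContinuousLinearMap.id ℝ ℝ) (Module.Basis.singleton Unit ℝ) 0 0 0 =
      ∑ i ∈ Finset.range (K + 1), r ^ i :=
  polWindow_nested_origin F (fun _ i => r ^ i) K j

/-- **THE VOLUME INCREMENT AT THE ORIGIN ENTRY IS EXACTLY `r^{K+1}`** — the windowed kernel of the ONE new class. -/
theorem polWindow_nested_hard_increment (K j : ℕ) :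
    polWindow F (K + 1) j (fun W : Fin (F.P (K + 1)).d → Site (F.P (K + 1)) j → ℝ =>
          ∑ i ∈ Finset.range (K + 1 + 1), r ^ i * W (Fin.cast (F.P_d (K + 1)).symm 0) (siteOfInt F (K + 1) j 0)) (ContinuousLinearMap.id ℝ ℝ)
          (Module.Basis.singleton Unit ℝ) 0 0 0 -
        polWindow F K j (fun W : Fin (F.P K).d → Site (F.P K) j → ℝ =>
          ∑ i ∈ Finset.range (K + 1), r ^ i * W (Fin.cast (F.P_d K).symm 0) (siteOfInt F K j 0)) (ContinuousLinearMap.id ℝ ℝ) (Module.Basis.singleton Unit ℝ) 0 0 0 =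
      r ^ (K + 1) := by
  rw [polWindow_nested_hard_origin, polWindow_nested_hard_origin, Finset.sum_range_succ, add_sub_cancel_left]

/-- ★★ **NON-DEGENERACY (1): THE WINDOWED KERNELS ARE STRICTLY INCREASING IN THE VOLUME** at the origin entry (`0 < r`): every new torus adds the strictly positive kernel
`r^{K+1}` of its new class. -/
theorem strictMono_polWindow_nested_hard (j : ℕ) (hr₀ : 0 < r) :
    StrictMono fun K : ℕ => polWindow F K j (fun W : Fin (F.P K).d → Site (F.P K) j → ℝ =>
        ∑ i ∈ Finset.range (K + 1), r ^ i * W (Fin.cast (F.P_d K).symm 0) (siteOfInt F K j 0)) (ContinuousLinearMap.id ℝ ℝ) (Module.Basis.singleton Unit ℝ) 0 0 0 := by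
  refine strictMono_nat_of_lt_succ fun K => sub_pos.1 ?_
  rw [polWindow_nested_hard_increment]
  exact pow_pos hr₀ _

/-- ★★ **NON-DEGENERACY (2): NOT EVENTUALLY CONSTANT** — the hypothesis of dag-n22-w3 g2's `polLimitExists_of_eventually_const` (and the `C := 0` case of the increments letter
behind dag-n18-w2's `polLimitsExist_fading`) FAILS for this family: the (1.21) limit here is NOT reached at any finite volume. -/
theorem not_eventuallyConst_polWindow_nested_hard (j : ℕ) (hr₀ : 0 < r) :
    ¬ ∃ (K₀ : ℕ) (P : ℝ), ∀ K : ℕ, K₀ ≤ K → polWindow F K j (fun W : Fin (F.P K).d → Site (F.P K) j → ℝ =>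
        ∑ i ∈ Finset.range (K + 1), r ^ i * W (Fin.cast (F.P_d K).symm 0) (siteOfInt F K j 0)) (ContinuousLinearMap.id ℝ ℝ) (Module.Basis.singleton Unit ℝ) 0 0 0 = P := by
  rintro ⟨K₀, P, hP⟩
  have h := strictMono_polWindow_nested_hard F j hr₀ (Nat.lt_add_one K₀)
  dsimp only at h
  rw [hP K₀ le_rfl, hP (K₀ + 1) (Nat.le_succ K₀)] at h
  exact lt_irrefl P h

/-- **NON-DEGENERACY (3): THE INCREMENTS LETTER HOLDS AT NO CONSTANT `0`** (at any ratio `q`, from any threshold) — unlike every model in the tree, whose increments vanish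
eventually. -/
theorem not_zeroIncrements_polWindow_nested_hard (j : ℕ) (hr₀ : 0 < r) (q : ℝ) (K₀ : ℕ) :
    ¬ ∀ K : ℕ, K₀ ≤ K → |polWindow F (K + 1) j (fun W : Fin (F.P (K + 1)).d → Site (F.P (K + 1)) j → ℝ =>
          ∑ i ∈ Finset.range (K + 1 + 1), r ^ i * W (Fin.cast (F.P_d (K + 1)).symm 0) (siteOfInt F (K + 1) j 0)) (ContinuousLinearMap.id ℝ ℝ)
          (Module.Basis.singleton Unit ℝ) 0 0 0 -
        polWindow F K j (fun W : Fin (F.P K).d → Site (F.P K) j → ℝ =>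
          ∑ i ∈ Finset.range (K + 1), r ^ i * W (Fin.cast (F.P_d K).symm 0) (siteOfInt F K j 0)) (ContinuousLinearMap.id ℝ ℝ) (Module.Basis.singleton Unit ℝ) 0 0 0| ≤
      0 * q ^ K := by
  intro h
  have h0 := h K₀ le_rfl
  rw [polWindow_nested_hard_increment, zero_mul, abs_of_pos (pow_pos hr₀ _)] at h0
  exact not_lt.2 h0 (pow_pos hr₀ _)

/-- **… WHILE IT HOLDS WITH THE NON-ZERO CONSTANT `r` AT RATIO `r` FROM `K₀ = 0`** (`0 ≤ r`): `|Π^{(K+1)} − Π^{(K)}| = r^{K+1} = r · r^K` at the origin entry. -/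
theorem increments_polWindow_nested_hard (j : ℕ) (hr₀ : 0 ≤ r) : ∀ K ≥ 0,
    |polWindow F (K + 1) j (fun W : Fin (F.P (K + 1)).d → Site (F.P (K + 1)) j → ℝ =>
          ∑ i ∈ Finset.range (K + 1 + 1), r ^ i * W (Fin.cast (F.P_d (K + 1)).symm 0) (siteOfInt F (K + 1) j 0)) (ContinuousLinearMap.id ℝ ℝ)
          (Module.Basis.singleton Unit ℝ) 0 0 0 -
        polWindow F K j (fun W : Fin (F.P K).d → Site (F.P K) j → ℝ =>
          ∑ i ∈ Finset.range (K + 1), r ^ i * W (Fin.cast (F.P_d K).symm 0) (siteOfInt F K j 0)) (ContinuousLinearMap.id ℝ ℝ) (Module.Basis.singleton Unit ℝ) 0 0 0| ≤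
      r * r ^ K := fun K _ => by
  rw [polWindow_nested_hard_increment, abs_of_nonneg (pow_nonneg hr₀ _), pow_succ, mul_comm]

/-- ★★ **THE (1.21) LIMIT AT THE ORIGIN ENTRY IS `(1 − r)⁻¹`** (`0 ≤ r < 1`; `hasSum_geometric_of_lt_one`). -/
theorem tendsto_polWindow_nested_hard (j : ℕ) (hr : r < 1) (hr₀ : 0 ≤ r) :
    Tendsto (fun K : ℕ => polWindow F K j (fun W : Fin (F.P K).d → Site (F.P K) j → ℝ =>
        ∑ i ∈ Finset.range (K + 1), r ^ i * W (Fin.cast (F.P_d K).symm 0) (siteOfInt F K j 0)) (ContinuousLinearMap.id ℝ ℝ) (Module.Basis.singleton Unit ℝ) 0 0 0)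
      atTop (𝓝 (1 - r)⁻¹) := by
  simp only [polWindow_nested_hard_origin]
  exact ((hasSum_geometric_of_lt_one hr₀ hr).tendsto_sum_nat).comp (tendsto_add_atTop_nat 1)

/-- The windowed kernels at the OTHER entries are eventually `0`, hence tend to `0`. -/
theorem tendsto_polWindow_nested_hard_of_ne (j : ℕ) {μ ν : Fin 4} {z : Fin 4 → ℤ} (h : ¬ (μ = 0 ∧ ν = 0 ∧ z = 0)) :
    Tendsto (fun K : ℕ => polWindow F K j (fun W : Fin (F.P K).d → Site (F.P K) j → ℝ =>
        ∑ i ∈ Finset.range (K + 1), r ^ i * W (Fin.cast (F.P_d K).symm 0) (siteOfInt F K j 0)) (ContinuousLinearMap.id ℝ ℝ) (Module.Basis.singleton Unit ℝ) μ ν z)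
      atTop (𝓝 0) := by
  refine tendsto_const_nhds.congr' ?_
  filter_upwards [polWindow_nested_eventually F (fun _ i => r ^ i) j μ ν z] with K hK
  rw [hK, if_neg h]

/-- ★★ **def-B's TOTAL (1.21) LIMIT `polLimit` OF THE HARD FAMILY, IN CLOSED FORM**: `[μ = ν = 0][z = 0] · (1 − r)⁻¹` — NON-ZERO at the origin entry. -/
theorem polLimit_nested_hard (j : ℕ) (hr : r < 1) (hr₀ : 0 ≤ r) (μ ν : Fin 4) (z : Fin 4 → ℤ) :
    polLimit F j (fun K (W : Fin (F.P K).d → Site (F.P K) j → ℝ) =>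
        ∑ i ∈ Finset.range (K + 1), r ^ i * W (Fin.cast (F.P_d K).symm 0) (siteOfInt F K j 0)) (ContinuousLinearMap.id ℝ ℝ) (Module.Basis.singleton Unit ℝ) μ ν z =
      if μ = 0 ∧ ν = 0 ∧ z = 0 then (1 - r)⁻¹ else 0 := by
  unfold polLimit
  split_ifs with h
  · obtain ⟨rfl, rfl, rfl⟩ := h
    exact (tendsto_polWindow_nested_hard F j hr hr₀).limUnder_eq
  · exact (tendsto_polWindow_nested_hard_of_ne F j h).limUnder_eq

/-- ★ **THE DISTANCE TO THE LIMIT IS EXACTLY `r^{K+1} ∕ (1 − r)`** at the origin entry, at EVERY volume (`r < 1`, geometric tail `Σ_{i > K} r^i`). -/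
theorem polLimit_sub_polWindow_nested_hard (K j : ℕ) (hr : r < 1) (hr₀ : 0 ≤ r) :
    polLimit F j (fun K (W : Fin (F.P K).d → Site (F.P K) j → ℝ) =>
          ∑ i ∈ Finset.range (K + 1), r ^ i * W (Fin.cast (F.P_d K).symm 0) (siteOfInt F K j 0)) (ContinuousLinearMap.id ℝ ℝ) (Module.Basis.singleton Unit ℝ) 0 0 0 -
        polWindow F K j (fun W : Fin (F.P K).d → Site (F.P K) j → ℝ =>
          ∑ i ∈ Finset.range (K + 1), r ^ i * W (Fin.cast (F.P_d K).symm 0) (siteOfInt F K j 0)) (ContinuousLinearMap.id ℝ ℝ) (Module.Basis.singleton Unit ℝ) 0 0 0 =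
      r ^ (K + 1) / (1 - r) := by
  rw [polLimit_nested_hard F j hr hr₀, if_pos ⟨rfl, rfl, rfl⟩, polWindow_nested_hard_origin, geom_sum_eq hr.ne,
    show (r ^ (K + 1) - 1) / (r - 1) = (1 - r ^ (K + 1)) / (1 - r) by rw [← neg_sub 1 (r ^ (K + 1)), ← neg_sub 1 r, neg_div_neg_eq],
    inv_eq_one_div, ← sub_div, sub_sub_cancel]

/-- **NON-DEGENERACY (4): THE LIMIT IS ATTAINED AT NO FINITE VOLUME** (`0 < r < 1`). -/
theorem polLimit_nested_hard_ne_polWindow (K j : ℕ) (hr : r < 1) (hr₀ : 0 < r) :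
    polLimit F j (fun K (W : Fin (F.P K).d → Site (F.P K) j → ℝ) =>
          ∑ i ∈ Finset.range (K + 1), r ^ i * W (Fin.cast (F.P_d K).symm 0) (siteOfInt F K j 0)) (ContinuousLinearMap.id ℝ ℝ) (Module.Basis.singleton Unit ℝ) 0 0 0 ≠
        polWindow F K j (fun W : Fin (F.P K).d → Site (F.P K) j → ℝ =>
          ∑ i ∈ Finset.range (K + 1), r ^ i * W (Fin.cast (F.P_d K).symm 0) (siteOfInt F K j 0)) (ContinuousLinearMap.id ℝ ℝ) (Module.Basis.singleton Unit ℝ) 0 0 0 := by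
  intro h
  have := polLimit_sub_polWindow_nested_hard F K j hr hr₀.le
  rw [h, sub_self] at this
  exact (div_pos (pow_pos hr₀ _) (sub_pos.2 hr)).ne this

/-- ★ **dag-n18-w2's (1.21) RATE IS SHARP**: its `abs_sub_limUnder_le_of_eventually_geometric` bounds the distance of a sequence with increments `≤ C q^K` (`K ≥ K₀`) to its `limUnder`
by `C q^K ∕ (1 − q)`; for the hard family at the origin entry (increments `r · r^K` from `K₀ = 0`, `increments_polWindow_nested_hard`) the bound `r · r^K ∕ (1 − r)` IS the distance. -/
theorem rate_sharp_nested_hard (K j : ℕ) (hr : r < 1) (hr₀ : 0 ≤ r) :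
    |polWindow F K j (fun W : Fin (F.P K).d → Site (F.P K) j → ℝ =>
          ∑ i ∈ Finset.range (K + 1), r ^ i * W (Fin.cast (F.P_d K).symm 0) (siteOfInt F K j 0)) (ContinuousLinearMap.id ℝ ℝ) (Module.Basis.singleton Unit ℝ) 0 0 0 -
        limUnder atTop (fun K : ℕ => polWindow F K j (fun W : Fin (F.P K).d → Site (F.P K) j → ℝ =>
          ∑ i ∈ Finset.range (K + 1), r ^ i * W (Fin.cast (F.P_d K).symm 0) (siteOfInt F K j 0)) (ContinuousLinearMap.id ℝ ℝ) (Module.Basis.singleton Unit ℝ) 0 0 0)| =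
      r * r ^ K / (1 - r) ∧
    |polWindow F K j (fun W : Fin (F.P K).d → Site (F.P K) j → ℝ =>
          ∑ i ∈ Finset.range (K + 1), r ^ i * W (Fin.cast (F.P_d K).symm 0) (siteOfInt F K j 0)) (ContinuousLinearMap.id ℝ ℝ) (Module.Basis.singleton Unit ℝ) 0 0 0 -
        limUnder atTop (fun K : ℕ => polWindow F K j (fun W : Fin (F.P K).d → Site (F.P K) j → ℝ =>
          ∑ i ∈ Finset.range (K + 1), r ^ i * W (Fin.cast (F.P_d K).symm 0) (siteOfInt F K j 0)) (ContinuousLinearMap.id ℝ ℝ) (Module.Basis.singleton Unit ℝ) 0 0 0)| ≤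
      r * r ^ K / (1 - r) := by
  refine ⟨?_, abs_sub_limUnder_le_of_eventually_geometric
    (a := fun K : ℕ => polWindow F K j (fun W : Fin (F.P K).d → Site (F.P K) j → ℝ =>
      ∑ i ∈ Finset.range (K + 1), r ^ i * W (Fin.cast (F.P_d K).symm 0) (siteOfInt F K j 0)) (ContinuousLinearMap.id ℝ ℝ) (Module.Basis.singleton Unit ℝ) 0 0 0)
    hr (increments_polWindow_nested_hard F j hr₀) (Nat.zero_le K)⟩
  have h := polLimit_sub_polWindow_nested_hard F K j hr hr₀
  unfold polLimit at h
  rw [abs_sub_comm, h, pow_succ, mul_comm, abs_of_nonneg (div_nonneg (by positivity) (sub_nonneg.2 hr.le))]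

end HardInstance

end YMDAG.N22.AtKernels.NestedTermsModel

end
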